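import Summits.RiemannHypothesis.RiemannHypothesis.Theorems.WeilTwoPrimeDeflE25OBase
import Summits.RiemannHypothesis.RiemannHypothesis.Theorems.WeilTwoPrimeDeflE25ODataR
import Literature.NumberTheory.LFunctions.WeilTwoPrimeCellsT120
import Literature.NumberTheory.LFunctions.WeilTwoPrimeCertificateDeflated
import HarnessLib

/-!
# Deflated two-prime certificate E25O: the certificate `weilCertDeflE25O : WeilCert23` and its augmented coefficient matrix

`weilCertDeflE25O` = base `weilCertDeflE25OBase` + `j = 5` + `pnu = 64` + the cells `weilTwoPrimeCellsT120` + support `b = 10059/12500` + the table `weilCertDeflE25ONu`; penalty data `weilCertDeflE25OR`; `weilCertDeflE25OP = P_r + Σ μ ĉ ĉᵀ`. [cite: Yoshida1992, §6, Thm 1 p. 310] Data only.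
(Re-landed byte-identical in its declarations: the hub olean of the first landing was never built — prover B g6.)
-/

set_option linter.dupNamespace false

noncomputable section

namespace Summit.RiemannHypothesis.RiemannHypothesis.Theorems.EvenWinsBeyondArch

open Literature.NumberTheory.LFunctions

/-- **The deflated two-prime certificate E25O** (`a₀ = b = 10059/12500`, `N = 271`, `T = 120`, `β₂₃ = 17/25`, k_odd = 6). [folklore] -/
def weilCertDeflE25O : WeilCert23 := ⟨weilCertDeflE25OBase, 5, 64, weilTwoPrimeCellsT120, 10059/12500, weilCertDeflE25ONu⟩

/-- The base of `weilCertDeflE25O` is `weilCertDeflE25OBase` (definitional). [folklore] -/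
theorem weilCertDeflE25O_base : weilCertDeflE25O.base = weilCertDeflE25OBase := rfl

/-- The table of `weilCertDeflE25O` is `weilCertDeflE25ONu` (definitional). [folklore] -/
theorem weilCertDeflE25O_nuTab : weilCertDeflE25O.nuTab = weilCertDeflE25ONu := rfl

/-- The augmented coefficient matrix `P_r + Σ μ ĉ ĉᵀ` of certificate E25O. [folklore] -/
def weilCertDeflE25OP (k l : ℕ) : ℚ := weilCertDeflE25OBase.prQ weilCertDeflE25ONu k l + rankOneQ weilCertDeflE25OR k l

/-- `weilCertDeflE25OP` is the augmented matrix of the certificate (definitional). [folklore] -/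
theorem weilCertDeflE25OP_eq : weilCertDeflE25OP = fun k l ↦ weilCertDeflE25O.base.prQ weilCertDeflE25O.nuTab k l + rankOneQ weilCertDeflE25OR k l := rfl

end Summit.RiemannHypothesis.RiemannHypothesis.Theorems.EvenWinsBeyondArch
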